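import Mathlib
import HarnessLib
import Summits.HubbardSuperconductivity.HubbardSuperconductivity.Theorems.KLProgrammeKLRegimeEngineTowerMeasuredSubadditive
import Summits.HubbardSuperconductivity.HubbardSuperconductivity.Theorems.KLProgrammeKLRegimeEngineNormsJumpLastLegCount
import Summits.HubbardSuperconductivity.HubbardSuperconductivity.Theorems.KLProgrammeH10TwoPointLimitSectorMultiplierJumpRegime
import Summits.HubbardSuperconductivity.HubbardSuperconductivity.Theorems.KLProgrammeKLRegimeWickCrossContractionSupport

/-!
# Route `KLProgramme` — crux K3 ENGINE (stmt-HubbardSuperconductivity-20437 `KLRegimeEngineV17F2`), stub (b) v2, THE LEVELS PACKAGE (ℓ):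
# instantiation (I2), THE JUMP HALF (levelled track) — a levelled norm RE-MEASURED at a finer thin family is at most the BORN levelled size at the
# coarse family times the relative count with one determined leg (E1-LEVELS-BLUEPRINT-g8 §3 (I2); cell gate-hubbard-kl, seat hubbard-kl-k3c2-p3 g10)

E1's `…EngineTowerMeasuredSubadditive` is the LINEARITY half of (I2): the measured levelled size of the input `𝒱_{dk} = 𝒱_0 + Σ_{k′<k} Δ_{k′}` of block `k`
at `F_{dk−1}` is at most the sum of the summands' sizes RE-MEASURED at `F_{dk−1}` (`klTowerMeasLev_le_remeasured_sum`).  This file is the JUMP half, in E1's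
carrier `klLevNormOf L M β μ K J m T Ωe` (`…EngineTowerModelDefs` §2): for ANY momentum-conserving Grassmann element `T` and thin families `F_k`, `F_{J′}` with
`k + 1 ≤ J′` (so `F_{J′}` lives in the plateau of `F_k`), every levelled norm of `T` at `F_{J′}` and prescription `Ωe` is at most
`C_m · 2^{(J′−k)·(m − levelCount Ωe)}` times the supremum of the levelled norms of `T` at `F_k` over the coarse prescriptions OF THE SAME LEVEL —
Benfatto–Giuliani–Mastropietro 2006 (2.82)–(2.84), (2.88)–(2.90): one overlap `L¹` norm per leg (`TorusFourierL2.overlap_jump_sums_klEng`, no window) and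
the number of fine label tuples refining a coarse one through the prescribed legs with ONE further leg determined by momentum conservation (p4 g11's
`card_relCount_prescribed_lastLeg_klAniso_le_window`, uniform on and off the umklapp-corner class, so no on-class split is needed at this count).
The re-sectorisation itself is k3c2-p3 g6's `hubbardSectorPrescribedSum_klAniso_jump_le_split` (run with the empty class `B = ∅`).

* §1 bookkeeping: `klTowerIncr_momentumConserving` (the block increments conserve momentum; `kernel_add`/`kernel_smul`), `klLevNormOf_nonneg`, `klTowerBornLev_nonneg`,
  the leg-set cardinalities and the count arithmetic `27^{|E|}·D·(27·2^Δ)^{(m+1)−|E|−1} ≤ D·27^{m+1}·(2^Δ)^{m−F}` (`F ≤ |E| ≤ F+1`);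
* §2 **`klLevNormOf_jump_le_of_consts`** — the jump at ABSTRACT per-pair overlap sums `c₁`, `c₁r` and count constant `D` (p4's literal count shape):
  `klLevNormOf … J′ (m+1) T Ωe ≤ c₁^m·c₁r·ε^{m+1}·(D·27^{m+1})·(2^{J′−k})^{m − levelCount Ωe}·N` whenever `klLevNormOf … k (m+1) T Ωe′ ≤ N` for every coarse
  prescription `Ωe′` with `levelCount Ωe′ = levelCount Ωe`;
* §3 **`klLevNormOf_jump_le_klEng`** — the same with the constants DISCHARGED under the binders of `stub_engine_step_norms` (`P.WF`, `R.WF2`, `c ≤ klEngC₃6`,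
  `U ≤ klEngU₀9`, `klEngL₃`, `klEngM₃`, `FrameOK R U (nScales β) μ K`, `k + 1 ≤ J′ ≤ nScales β + 1`) plus the count's own thresholds `c ≤ c₃′(R)`, `U ≤ U₀′(R)`:
  `∀ m, ∃ C_m > 0, ∀ R, ∃ c₃′ U₀′ > 0, … klLevNormOf … J′ (m+1) T Ωe ≤ C_m·(2^{J′−k})^{m − levelCount Ωe}·N`;
* §4 the TOWER instances: **`klLevNormOf_klTowerIncr_remeasure_le_klEng`** — the increment `Δ_{k′}` (born at `F_{dk′}`) re-measured at `F_{dk−1}` (`k′ < k`, `2 ≤ d`)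
  is `≤ C_m·(2^{(dk−1)−dk′})^{m−F}·klTowerBornLev … d k′ (m+1) F` at every prescription of level `F`; **`klLevNormOf_scaleZero_remeasure_le_klEng`** — the UV
  summand `𝒱_0[K]` (sizes at `F_0` = `klAnisoLegKernelNormAt … 0`, the level-0 law's carrier) re-measured at `F_{dk−1}`.
  With `klTowerMeasLev_le_remeasured_sum` these give the kit's `hμ` row in absolute units; the dimensionless dictionary (units `2^{(3p−5)J}`, `g = 2^{−(d−1)}`)
  is E1's (I6)/(I7) bookkeeping and is not done here.
Everything is proved; no definitions; nothing about the model is asserted; nothing asserts superconductivity.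
References: BGM 2006 §2.8 (2.76), (2.82)–(2.84), (2.88)–(2.90), App. A3 Lemma A3.1 [cite: BenfattoGiulianiMastropietro2006].
-/

noncomputable section

namespace Summit.HubbardSuperconductivity.HubbardSuperconductivity.Theorems.EngineV8

set_option linter.dupNamespace false -- summit = problem name (single-conjunct summit), D-0017

open Classical
open Real Finset Literature.MathematicalPhysics.QuantumLattice Literature.Probability.LatticeModels GrassmannAlgebra
open Literature.MathematicalPhysics.QuantumLattice.FermiRG
open Summit.HubbardSuperconductivity.HubbardSuperconductivity.Theorems.KLRegimeSplit
open Summit.HubbardSuperconductivity.HubbardSuperconductivity.Theorems.KLProgrammeLegKernels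
open Summit.HubbardSuperconductivity.HubbardSuperconductivity.Theorems.DispersionFlow
open Summit.HubbardSuperconductivity.HubbardSuperconductivity.Theorems.KLRegimeWick
open Summit.HubbardSuperconductivity.HubbardSuperconductivity.Theorems.TorusFourierL2

variable {L M : ℕ} [NeZero L] [NeZero M]

/-! ## §1 Bookkeeping -/

/-- **The block increments `Δ_k = 𝒱_{d(k+1)}[K] − 𝒱_{dk}[K]` conserve momentum** (signed-momentum form of `bgmSectorSet`). -/
theorem klTowerIncr_momentumConserving (β U μ : ℝ) (K : TrigPolyC4v) (d k m : ℕ) (X : Fin m → HubbardFieldIdx L M)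
    (h : ∑ i, signedMomentum L (X i).2 (X i).1.1.2 ≠ 0) : kernel ℂ (klTowerIncr L M β U μ K d k) m X = 0 := by
  unfold klTowerIncr
  rw [sub_eq_add_neg, kernel_add, ← neg_one_smul ℂ (klEffectiveAction L M β U μ K klE0 (d * k)), kernel_smul,
    klEffectiveAction_momentumConserving β U μ K klE0 _ m X h, klEffectiveAction_momentumConserving β U μ K klE0 _ m X h, mul_zero, add_zero]

omit [NeZero M] in
/-- The levelled norm is nonnegative (`0 ≤ β`). -/
theorem klLevNormOf_nonneg {β : ℝ} (hβ : 0 ≤ β) (μ : ℝ) (K : TrigPolyC4v) (J m : ℕ) (T : HubbardGrassmann L M)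
    (Ωe : Fin m → Option (SectorLeg (sectorCount J))) : 0 ≤ klLevNormOf L M β μ K J m T Ωe :=
  hubbardSectorKernelNorm_nonneg hβ _ _ _

omit [NeZero M] in
/-- The born levelled size is nonnegative (`0 ≤ β`; an empty level gives the supremum `0`). -/
theorem klTowerBornLev_nonneg {β : ℝ} (hβ : 0 ≤ β) (U μ : ℝ) (K : TrigPolyC4v) (d k m F : ℕ) : 0 ≤ klTowerBornLev L M β U μ K d k m F := by
  unfold klTowerBornLev
  rcases isEmpty_or_nonempty {Ωe : Fin m → Option (SectorLeg (sectorCount (d * k))) // levelCount Ωe = F} with h | h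
  · rw [Real.iSup_of_isEmpty]
  · exact le_ciSup_of_le (Set.finite_range _).bddAbove (Classical.arbitrary _) (klLevNormOf_nonneg hβ μ K _ m _ _)

section LegSet

variable {m N : ℕ}

/-- The leg set «prescribed legs of `Ωe` together with the pinned leg `p`» has at least `levelCount Ωe` elements. -/
theorem levelCount_le_card_legSet (Ωe : Fin (m + 1) → Option (SectorLeg N)) (p : Fin (m + 1)) :
    levelCount Ωe ≤ (univ.filter fun i : Fin (m + 1) => (Ωe i).isSome ∨ i = p).card := by
  rw [levelCount]
  exact card_le_card fun i hi => by
    simp only [mem_filter, mem_univ, true_and] at hi ⊢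
    exact Or.inl hi

/-- … and at most `levelCount Ωe + 1` elements. -/
theorem card_legSet_le_levelCount_succ (Ωe : Fin (m + 1) → Option (SectorLeg N)) (p : Fin (m + 1)) :
    (univ.filter fun i : Fin (m + 1) => (Ωe i).isSome ∨ i = p).card ≤ levelCount Ωe + 1 := by
  rw [levelCount]
  have hsub : (univ.filter fun i : Fin (m + 1) => (Ωe i).isSome ∨ i = p) ⊆ (univ.filter fun i : Fin (m + 1) => (Ωe i).isSome) ∪ {p} := by
    intro i hi
    simp only [mem_filter, mem_univ, true_and] at hi
    rcases hi with hi | rfl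
    · exact mem_union_left _ (mem_filter.2 ⟨mem_univ _, hi⟩)
    · exact mem_union_right _ (mem_singleton_self _)
  exact (card_le_card hsub).trans ((card_union_le _ _).trans (by simp))

/-- … and at most `m + 1` elements. -/
theorem card_legSet_le_succ (Ωe : Fin (m + 1) → Option (SectorLeg N)) (p : Fin (m + 1)) :
    (univ.filter fun i : Fin (m + 1) => (Ωe i).isSome ∨ i = p).card ≤ m + 1 :=
  (card_le_univ _).trans_eq (Fintype.card_fin _)

/-- Replacing the prescribed labels keeps the level: `levelCount (i ↦ (Ωe i).map (fun _ ↦ τ′ i)) = levelCount Ωe`. -/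
theorem levelCount_map_const {N' : ℕ} (Ωe : Fin (m + 1) → Option (SectorLeg N)) (τ' : Fin (m + 1) → SectorLeg N') :
    levelCount (fun i => (Ωe i).map fun _ => τ' i) = levelCount Ωe := by
  simp [levelCount, Option.isSome_map]

end LegSet

/-- **The count arithmetic**: for `F ≤ e ≤ F + 1`, `e ≤ m + 1`, `0 ≤ D`:
`27^e · (D · (27·2^Δ)^{(m+1)−e−1}) ≤ D · 27^{m+1} · (2^Δ)^{m−F}`. -/
theorem legSet_count_arith {D : ℝ} (hD : 0 ≤ D) (Δ m F e : ℕ) (hFe : F ≤ e) (he : e ≤ m + 1) :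
    (27 : ℝ) ^ e * (D * (((27 * 2 ^ Δ : ℕ) : ℝ)) ^ ((m + 1) - e - 1)) ≤ D * 27 ^ (m + 1) * ((2 : ℝ) ^ Δ) ^ (m - F) := by
  have hexp : (m + 1) - e - 1 = m - e := by omega
  rw [hexp]
  push_cast
  rw [mul_pow]
  have h27 : (27 : ℝ) ^ (e + (m - e)) ≤ 27 ^ (m + 1) := pow_le_pow_right₀ (by norm_num) (by omega)
  have h2 : ((2 : ℝ) ^ Δ) ^ (m - e) ≤ ((2 : ℝ) ^ Δ) ^ (m - F) := pow_le_pow_right₀ (one_le_pow₀ (by norm_num)) (by omega)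
  calc (27 : ℝ) ^ e * (D * ((27 : ℝ) ^ (m - e) * ((2 : ℝ) ^ Δ) ^ (m - e)))
      = D * ((27 : ℝ) ^ (e + (m - e))) * ((2 : ℝ) ^ Δ) ^ (m - e) := by rw [pow_add]; ring
    _ ≤ D * 27 ^ (m + 1) * ((2 : ℝ) ^ Δ) ^ (m - F) :=
        mul_le_mul (mul_le_mul_of_nonneg_left h27 hD) h2 (by positivity) (by positivity)

/-! ## §2 The jump at abstract overlap / count constants -/

/-- **THE LEVELLED JUMP at abstract constants** (BGM 2006 (2.82)–(2.84), (2.88)–(2.90)).  For `k + 1 ≤ J′`, a momentum-conserving `T`, per-pair column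
sums `≤ c₁` and row sums `≤ c₁r` of `‖E(klAnisoFamily J′)·S(F̃_k)‖` (labels matched), and the relative count with the prescribed legs fixed and one
further leg determined (p4's shape, constant `D`): if every coarse prescription `Ωe′` of the same level as `Ωe` has `klLevNormOf … k (m+1) T Ωe′ ≤ N`, then
`klLevNormOf … J′ (m+1) T Ωe ≤ c₁^m·c₁r·ε^{m+1}·(D·27^{m+1})·(2^{J′−k})^{m − levelCount Ωe}·N` (`ε = imagTimeWeight β M`).
[cite: BenfattoGiulianiMastropietro2006, §2.8 (2.82)-(2.84), (2.88)-(2.90)] -/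
theorem klLevNormOf_jump_le_of_consts {β : ℝ} (hβ : 0 < β) (μ : ℝ) (K : TrigPolyC4v) {k J' : ℕ} (hJ : k + 1 ≤ J')
    (T : HubbardGrassmann L M)
    (hT : ∀ (m : ℕ) (X : Fin m → HubbardFieldIdx L M), ∑ i, signedMomentum L (X i).2 (X i).1.1.2 ≠ 0 → kernel ℂ T m X = 0)
    {c₁ c₁r D : ℝ} (hc₁0 : 0 ≤ c₁) (hc₁r0 : 0 ≤ c₁r) (hD : 0 ≤ D)
    (hcol₁ : ∀ (ω'' : Fin (sectorCount J')) (ω' : Fin (sectorCount k)) (σ c : Fin 2) (x' : SpaceTimeIdx L M),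
      ∑ x'' : SpaceTimeIdx L M, ‖(sectorAnalysisMatrix L M β (klAnisoFamily L M β μ K klE0 J') *
        sectorSubMatrix L M β (bgmFatMultiplier L M klE0 β (nambuXiCT L μ K) k)) (x'', ((ω'', σ), c)) (x', ((ω', σ), c))‖ ≤ c₁)
    (hrow₁ : ∀ (ω'' : Fin (sectorCount J')) (ω' : Fin (sectorCount k)) (σ c : Fin 2) (x'' : SpaceTimeIdx L M),
      ∑ x' : SpaceTimeIdx L M, ‖(sectorAnalysisMatrix L M β (klAnisoFamily L M β μ K klE0 J') *
        sectorSubMatrix L M β (bgmFatMultiplier L M klE0 β (nambuXiCT L μ K) k)) (x'', ((ω'', σ), c)) (x', ((ω', σ), c))‖ ≤ c₁r)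
    (m : ℕ)
    (hcnt : ∀ (E : Finset (Fin (m + 1))) (τ'' : Fin (m + 1) → SectorLeg (sectorCount J'))
      (σ' : Fin (m + 1) → SectorLeg (sectorCount k)),
      ((((bgmSectorSet L M (klAnisoFamily L M β μ K klE0 J') (m + 1)).filter fun σ'' => (∀ e ∈ E, σ'' e = τ'' e) ∧ ∀ i,
        (∃ q : FreqMomentum L M, klAnisoFamily L M β μ K klE0 J' (σ'' i).1.1 q ≠ 0 ∧
          bgmFatMultiplier L M klE0 β (nambuXiCT L μ K) k (σ' i).1.1 q ≠ 0) ∧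
        (σ' i).1.2 = (σ'' i).1.2 ∧ (σ' i).2 = (σ'' i).2).card : ℝ)) ≤
        D * ((27 * 2 ^ (J' - k) : ℕ) : ℝ) ^ ((m + 1) - E.card - 1))
    (Ωe : Fin (m + 1) → Option (SectorLeg (sectorCount J'))) {N : ℝ} (hN0 : 0 ≤ N)
    (hN : ∀ Ωe' : Fin (m + 1) → Option (SectorLeg (sectorCount k)), levelCount Ωe' = levelCount Ωe →
      klLevNormOf L M β μ K k (m + 1) T Ωe' ≤ N) :
    klLevNormOf L M β μ K J' (m + 1) T Ωe ≤
      c₁ ^ m * c₁r * imagTimeWeight β M ^ (m + 1) * (D * 27 ^ (m + 1)) * ((2 : ℝ) ^ (J' - k)) ^ (m - levelCount Ωe) * N := by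
  have hε0 : 0 ≤ imagTimeWeight β M := imagTimeWeight_nonneg hβ.le M
  set ε := imagTimeWeight β M with hεdef
  set F' := klAnisoFamily L M β μ K klE0 J' with hF'
  set Fk := klAnisoFamily L M β μ K klE0 k with hFk
  have hC : 0 ≤ c₁ ^ m * c₁r * ε ^ (m + 1) * (D * 27 ^ (m + 1)) * ((2 : ℝ) ^ (J' - k)) ^ (m - levelCount Ωe) * N := by positivity
  rw [klLevNormOf, hubbardSectorKernelNorm_def]
  refine sectorisedKernelNorm_le_of_forall_le hC fun p s x => ?_
  -- the leg set and the fine prescription read by the leg sum at `(p, s)`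
  set E : Finset (Fin (m + 1)) := univ.filter fun i => (Ωe i).isSome ∨ i = p with hE
  set τ'' : Fin (m + 1) → SectorLeg (sectorCount J') := fun i => (Ωe i).getD s with hτ''
  have hpE : p ∈ E := by simp [hE]
  -- (1) the leg sum is dominated by the `E`-prescribed fine sum over `bgmSectorSet`
  have h1 : sectorLegSum ε (prescribedTuples (bgmSectorSet L M F' (m + 1)) Ωe) (sectorisedKernel L M β F' T (m + 1)) p s x ≤
      ε ^ m * ∑ σ'' ∈ (bgmSectorSet L M F' (m + 1)).filter (fun σ'' => ∀ e ∈ E, σ'' e = τ'' e),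
        ∑ x'' ∈ univ.filter (fun x'' : Fin (m + 1) → SpaceTimeIdx L M => x'' p = x),
          ‖sectorisedKernel L M β F' T (m + 1) σ'' x''‖ := by
    rw [sectorLegSum_def, ← mul_sum]
    refine mul_le_mul_of_nonneg_left (sum_le_sum_of_subset_of_nonneg ?_ fun _ _ _ => sum_nonneg fun _ _ => norm_nonneg _)
      (pow_nonneg hε0 m)
    intro Ω hΩ
    simp only [prescribedTuples, mem_filter] at hΩ ⊢
    refine ⟨hΩ.1.1, fun e he => ?_⟩
    have he' : (Ωe e).isSome ∨ e = p := by simpa [hE] using he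
    rcases he' with he' | rfl
    · obtain ⟨ℓ, hℓ⟩ := Option.isSome_iff_exists.1 he'
      rw [hτ'']
      simp only [hℓ, Option.getD_some]
      exact hΩ.1.2 e ℓ (by simp [hℓ])
    · show Ω e = (Ωe e).getD s
      rcases hcase : Ωe e with _ | ℓ
      · simpa using hΩ.2
      · simp only [Option.getD_some]
        exact hΩ.1.2 e ℓ (by simp [hcase])
  -- (2) the coarse `E`-prescribed sums are dominated by the coarse levelled norms of the same level
  have hN₁ : ∀ (τ' : Fin (m + 1) → SectorLeg (sectorCount k)) (y : SpaceTimeIdx L M),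
      ε ^ m * ∑ σ' ∈ univ.filter (fun σ' : Fin (m + 1) → SectorLeg (sectorCount k) => ∀ e ∈ E, σ' e = τ' e),
        ∑ x' ∈ univ.filter (fun x' : Fin (m + 1) → SpaceTimeIdx L M => x' p = y),
          ‖sectorisedKernel L M β Fk T (m + 1) σ' x'‖ ≤ N := by
    intro τ' y
    set Ωe' : Fin (m + 1) → Option (SectorLeg (sectorCount k)) := fun i => (Ωe i).map fun _ => τ' i with hΩe'
    have hlev : levelCount Ωe' = levelCount Ωe := levelCount_map_const Ωe τ'
    have hle : ε ^ m * ∑ σ' ∈ univ.filter (fun σ' : Fin (m + 1) → SectorLeg (sectorCount k) => ∀ e ∈ E, σ' e = τ' e),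
        ∑ x' ∈ univ.filter (fun x' : Fin (m + 1) → SpaceTimeIdx L M => x' p = y), ‖sectorisedKernel L M β Fk T (m + 1) σ' x'‖ ≤
        sectorLegSum ε (prescribedTuples (bgmSectorSet L M Fk (m + 1)) Ωe') (sectorisedKernel L M β Fk T (m + 1)) p (τ' p) y := by
      rw [sectorLegSum_def, ← mul_sum]
      refine mul_le_mul_of_nonneg_left ?_ (pow_nonneg hε0 m)
      have hsub : (bgmSectorSet L M Fk (m + 1)).filter (fun σ' : Fin (m + 1) → SectorLeg (sectorCount k) => ∀ e ∈ E, σ' e = τ' e) ⊆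
          univ.filter (fun σ' : Fin (m + 1) → SectorLeg (sectorCount k) => ∀ e ∈ E, σ' e = τ' e) :=
        filter_subset_filter _ (subset_univ _)
      rw [← Finset.sum_subset hsub ?_]
      · refine sum_le_sum_of_subset_of_nonneg ?_ fun _ _ _ => sum_nonneg fun _ _ => norm_nonneg _
        intro σ' hσ'
        simp only [mem_filter, prescribedTuples] at hσ' ⊢
        refine ⟨⟨hσ'.1, fun i ℓ hℓ => ?_⟩, hσ'.2 p hpE⟩
        have hi : (Ωe i).isSome := by
          rcases hcase : Ωe i with _ | ℓ₀
          · simp [hΩe', hcase] at hℓ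
          · simp
        have hℓ' : ℓ = τ' i := by
          obtain ⟨ℓ₀, hℓ₀⟩ := Option.isSome_iff_exists.1 hi
          simp [hΩe', hℓ₀] at hℓ
          exact hℓ.symm
        rw [hℓ']
        exact hσ'.2 i (by simp [hE, hi])
      · intro σ' hσ'univ hσ'not
        have hP := (mem_filter.1 hσ'univ).2
        have hnot : σ' ∉ bgmSectorSet L M Fk (m + 1) := fun h => hσ'not (mem_filter.2 ⟨h, hP⟩)
        exact sum_eq_zero fun x' _ => by rw [sectorisedKernel_eq_zero_of_not_mem_bgmSectorSet β Fk T hT hnot x', norm_zero]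
    refine hle.trans ((sectorLegSum_le_sectorisedKernelNorm ε _ _ p (τ' p) y).trans ?_)
    have h := hN Ωe' hlev
    rwa [klLevNormOf, hubbardSectorKernelNorm_def] at h
  -- (3) the re-sectorisation lemma with the empty on-class set
  have hX0 : (0 : ℝ) ≤ D * ((27 * 2 ^ (J' - k) : ℕ) : ℝ) ^ ((m + 1) - E.card - 1) := by positivity
  have h2 := hubbardSectorPrescribedSum_klAniso_jump_le_split (L := L) (M := M) hβ μ K hJ T hc₁0 hc₁r0 hX0 le_rfl hN0 le_rfl hcol₁ hrow₁ m
    (bgmSectorSet L M F' (m + 1)) ∅ E τ'' p hpE (fun σ' _ => hcnt E τ'' σ') (fun σ' h => absurd h (Finset.notMem_empty _)) hN₁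
    (fun τ' y => by simp) x
  -- (4) assemble
  refine h1.trans (h2.trans ?_)
  rw [zero_mul, add_zero]
  have harith := legSet_count_arith hD (J' - k) m (levelCount Ωe) E.card (levelCount_le_card_legSet Ωe p) (card_legSet_le_succ Ωe p)
  have hrest : 0 ≤ c₁ ^ m * c₁r * ε ^ (m + 1) * N := by positivity
  calc c₁ ^ m * c₁r * (27 : ℝ) ^ E.card * ε ^ m * (ε * (D * ((27 * 2 ^ (J' - k) : ℕ) : ℝ) ^ ((m + 1) - E.card - 1) * N))
      = (c₁ ^ m * c₁r * ε ^ (m + 1) * N) * ((27 : ℝ) ^ E.card * (D * ((27 * 2 ^ (J' - k) : ℕ) : ℝ) ^ ((m + 1) - E.card - 1))) := by ring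
    _ ≤ (c₁ ^ m * c₁r * ε ^ (m + 1) * N) * (D * 27 ^ (m + 1) * ((2 : ℝ) ^ (J' - k)) ^ (m - levelCount Ωe)) :=
        mul_le_mul_of_nonneg_left harith hrest
    _ = c₁ ^ m * c₁r * ε ^ (m + 1) * (D * 27 ^ (m + 1)) * ((2 : ℝ) ^ (J' - k)) ^ (m - levelCount Ωe) * N := by ring

/-! ## §3 The jump under the stub binders, constants discharged -/

/-- **THE LEVELLED JUMP IN THE KL REGIME, constants discharged** — under the binders of `stub_engine_step_norms` plus the count's thresholds
`c ≤ c₃′(R)`, `U ≤ U₀′(R)`: for every number of legs `m + 1` there is `C_m > 0` such that for every momentum-conserving `T`, scales `k + 1 ≤ J′ ≤ nScales β + 1`,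
prescription `Ωe` and bound `N` of the coarse levelled norms of the same level,
`klLevNormOf … J′ (m+1) T Ωe ≤ C_m·(2^{J′−k})^{m − levelCount Ωe}·N`. [cite: BenfattoGiulianiMastropietro2006, §2.8 (2.82)-(2.84), (2.88)-(2.90)] -/
theorem klLevNormOf_jump_le_klEng (m : ℕ) :
    ∃ C : ℝ, 0 < C ∧ ∀ R : RenConsts, R.WF2 → ∃ c₃' : ℝ, 0 < c₃' ∧ ∃ U₀' : ℝ, 0 < U₀' ∧
      ∀ (P : SplitConsts) (c : ℝ), P.WF → 0 < c → c ≤ klEngC₃6 P R → c ≤ c₃' →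
      ∀ μ ∈ klWindowC, ∀ U : ℝ, 0 < U → U ≤ klEngU₀9 P R c → U ≤ U₀' → ∀ β : ℝ, klBetaMin ≤ β → β ≤ Real.exp (c / U ^ 2) →
      ∀ K : TrigPolyC4v, FrameOK R U (nScales β) μ K → ∀ (L M : ℕ) [NeZero L] [NeZero M],
      klEngL₃ β U ≤ L → klEngM₃ β U L ≤ M → ∀ k J' : ℕ, k + 1 ≤ J' → J' ≤ nScales β + 1 →
      ∀ T : HubbardGrassmann L M,
        (∀ (m' : ℕ) (X : Fin m' → HubbardFieldIdx L M), ∑ i, signedMomentum L (X i).2 (X i).1.1.2 ≠ 0 → kernel ℂ T m' X = 0) →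
      ∀ (Ωe : Fin (m + 1) → Option (SectorLeg (sectorCount J'))) (N : ℝ), 0 ≤ N →
        (∀ Ωe' : Fin (m + 1) → Option (SectorLeg (sectorCount k)), levelCount Ωe' = levelCount Ωe →
          klLevNormOf L M β μ K k (m + 1) T Ωe' ≤ N) →
        klLevNormOf L M β μ K J' (m + 1) T Ωe ≤ C * ((2 : ℝ) ^ (J' - k)) ^ (m - levelCount Ωe) * N := by
  obtain ⟨CJ, hCJ, hov⟩ := overlap_jump_sums_klEng
  obtain ⟨D, hD, hreg⟩ := card_relCount_prescribed_lastLeg_klAniso_le_window m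
  refine ⟨(3 * CJ / 2) ^ (m + 1) * (D * 27 ^ (m + 1)), by positivity, fun R hR2 => ?_⟩
  have hRj : ∀ j, 0 ≤ R.Gfr j := gfr_nonneg_of_wf2 hR2
  obtain ⟨c₃, hc₃, U₀, hU₀, hcnt⟩ := hreg R hRj
  refine ⟨c₃, hc₃, U₀, hU₀, ?_⟩
  intro P c hP hc hc6 hc₃' μ hμ U hU hU9 hU₀' β hβmin hβc K hK L M _ _ hL3 hM3 k J' hJ hJN T hT Ωe N hN0 hN
  have hβ : 0 < β := KLRegimeSplit.pos_of_klBetaMin_le hβmin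
  obtain ⟨_, hcol₁, hrow₁⟩ := hov P R c hP hR2 hc hc6 μ hμ U hU hU9 β hβmin hβc K hK L M hL3 hM3 k J' hJ hJN
  have hc₁0 : (0 : ℝ) ≤ 3 * CJ * M / β := by positivity
  have h := klLevNormOf_jump_le_of_consts hβ μ K hJ T hT hc₁0 hc₁0 hD.le hcol₁ hrow₁ m
    (fun E τ'' σ' => hcnt c hc hc₃' U hU hU₀' β hβmin hβc μ hμ μ K hK L M k J' (by omega) _ subset_rfl E τ'' σ') Ωe hN0 hN
  have hMne : (M : ℝ) ≠ 0 := by exact_mod_cast NeZero.ne M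
  have hεc : imagTimeWeight β M * (3 * CJ * M / β) = 3 * CJ / 2 := by
    unfold imagTimeWeight; field_simp
  have hconst : (3 * CJ * M / β) ^ m * (3 * CJ * M / β) * imagTimeWeight β M ^ (m + 1) = (3 * CJ / 2) ^ (m + 1) := by
    rw [← pow_succ, ← mul_pow, mul_comm (3 * CJ * M / β), hεc]
  calc klLevNormOf L M β μ K J' (m + 1) T Ωe
      ≤ (3 * CJ * M / β) ^ m * (3 * CJ * M / β) * imagTimeWeight β M ^ (m + 1) * (D * 27 ^ (m + 1)) *
          ((2 : ℝ) ^ (J' - k)) ^ (m - levelCount Ωe) * N := h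
    _ = (3 * CJ / 2) ^ (m + 1) * (D * 27 ^ (m + 1)) * ((2 : ℝ) ^ (J' - k)) ^ (m - levelCount Ωe) * N := by rw [hconst]

/-! ## §4 The tower instances: an increment born at `F_{dk′}` and the scale-`0` action, re-measured at `F_{dk−1}` -/

/-- Block arithmetic: `k′ < k` and `2 ≤ d` give `dk′ + 1 ≤ dk − 1`. -/
theorem block_jump_le {d k k' : ℕ} (hd : 2 ≤ d) (hk : k' < k) : d * k' + 1 ≤ d * k - 1 := by
  have h1 : d * k' + d ≤ d * k := by rw [← Nat.mul_succ]; exact Nat.mul_le_mul_left d hk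
  omega

/-- **THE INCREMENT `Δ_{k′}` RE-MEASURED AT `F_{dk−1}`** (`k′ < k`, `2 ≤ d`, `dk − 1 ≤ nScales β + 1`): under the binders of §3, at every prescription `Ωe` of
level `F`, `klLevNormOf … (dk−1) (m+1) Δ_{k′} Ωe ≤ C_m·(2^{(dk−1)−dk′})^{m−F}·klTowerBornLev … d k′ (m+1) F` — the summand `k′` of E1's
`klTowerMeasLev_le_remeasured_sum` against the BORN levelled size. [cite: BenfattoGiulianiMastropietro2006, §2.8 (2.82)-(2.84), (2.88)-(2.90)] -/
theorem klLevNormOf_klTowerIncr_remeasure_le_klEng (m : ℕ) :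
    ∃ C : ℝ, 0 < C ∧ ∀ R : RenConsts, R.WF2 → ∃ c₃' : ℝ, 0 < c₃' ∧ ∃ U₀' : ℝ, 0 < U₀' ∧
      ∀ (P : SplitConsts) (c : ℝ), P.WF → 0 < c → c ≤ klEngC₃6 P R → c ≤ c₃' →
      ∀ μ ∈ klWindowC, ∀ U : ℝ, 0 < U → U ≤ klEngU₀9 P R c → U ≤ U₀' → ∀ β : ℝ, klBetaMin ≤ β → β ≤ Real.exp (c / U ^ 2) →
      ∀ K : TrigPolyC4v, FrameOK R U (nScales β) μ K → ∀ (L M : ℕ) [NeZero L] [NeZero M],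
      klEngL₃ β U ≤ L → klEngM₃ β U L ≤ M → ∀ d k k' : ℕ, 2 ≤ d → k' < k → d * k - 1 ≤ nScales β + 1 →
      ∀ Ωe : Fin (m + 1) → Option (SectorLeg (sectorCount (d * k - 1))),
        klLevNormOf L M β μ K (d * k - 1) (m + 1) (klTowerIncr L M β U μ K d k') Ωe ≤
          C * ((2 : ℝ) ^ (d * k - 1 - d * k')) ^ (m - levelCount Ωe) * klTowerBornLev L M β U μ K d k' (m + 1) (levelCount Ωe) := by
  obtain ⟨C, hC, h⟩ := klLevNormOf_jump_le_klEng m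
  refine ⟨C, hC, fun R hR2 => ?_⟩
  obtain ⟨c₃, hc₃, U₀, hU₀, h'⟩ := h R hR2
  refine ⟨c₃, hc₃, U₀, hU₀, ?_⟩
  intro P c hP hc hc6 hc₃' μ hμ U hU hU9 hU₀' β hβmin hβc K hK L M _ _ hL3 hM3 d k k' hd hk hkN Ωe
  have hβ : 0 < β := KLRegimeSplit.pos_of_klBetaMin_le hβmin
  exact h' P c hP hc hc6 hc₃' μ hμ U hU hU9 hU₀' β hβmin hβc K hK L M hL3 hM3 (d * k') (d * k - 1) (block_jump_le hd hk) hkN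
    (klTowerIncr L M β U μ K d k') (fun m' X hX => klTowerIncr_momentumConserving β U μ K d k' m' X hX) Ωe
    (klTowerBornLev L M β U μ K d k' (m + 1) (levelCount Ωe)) (klTowerBornLev_nonneg hβ.le U μ K d k' (m + 1) _)
    (fun Ωe' hlev => by rw [← hlev]; exact klLevNormOf_le_klTowerBornLev β U μ K d k' (m + 1) Ωe')

/-- **THE SCALE-`0` ACTION `𝒱_0[K]` RE-MEASURED AT `F_{dk−1}`** (`1 ≤ dk − 1 ≤ nScales β + 1`): at every prescription `Ωe`,
`klLevNormOf … (dk−1) (m+1) 𝒱_0 Ωe ≤ C_m·(2^{dk−1})^{m − levelCount Ωe}·N₀` whenever the level-0 carriers `klAnisoLegKernelNormAt … klE0 0 (m+1) Ωe′` of the same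
level are `≤ N₀` (the UV summand of `klTowerMeasLev_le_remeasured_sum`; its supplier is the level-0 law). [cite: BenfattoGiulianiMastropietro2006, §2.8 (2.82)-(2.84)] -/
theorem klLevNormOf_scaleZero_remeasure_le_klEng (m : ℕ) :
    ∃ C : ℝ, 0 < C ∧ ∀ R : RenConsts, R.WF2 → ∃ c₃' : ℝ, 0 < c₃' ∧ ∃ U₀' : ℝ, 0 < U₀' ∧
      ∀ (P : SplitConsts) (c : ℝ), P.WF → 0 < c → c ≤ klEngC₃6 P R → c ≤ c₃' →
      ∀ μ ∈ klWindowC, ∀ U : ℝ, 0 < U → U ≤ klEngU₀9 P R c → U ≤ U₀' → ∀ β : ℝ, klBetaMin ≤ β → β ≤ Real.exp (c / U ^ 2) →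
      ∀ K : TrigPolyC4v, FrameOK R U (nScales β) μ K → ∀ (L M : ℕ) [NeZero L] [NeZero M],
      klEngL₃ β U ≤ L → klEngM₃ β U L ≤ M → ∀ J' : ℕ, 1 ≤ J' → J' ≤ nScales β + 1 →
      ∀ (Ωe : Fin (m + 1) → Option (SectorLeg (sectorCount J'))) (N₀ : ℝ), 0 ≤ N₀ →
        (∀ Ωe' : Fin (m + 1) → Option (SectorLeg (sectorCount 0)), levelCount Ωe' = levelCount Ωe →
          klAnisoLegKernelNormAt L M β U μ K klE0 0 (m + 1) Ωe' ≤ N₀) →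
        klLevNormOf L M β μ K J' (m + 1) (klEffectiveAction L M β U μ K klE0 0) Ωe ≤ C * ((2 : ℝ) ^ J') ^ (m - levelCount Ωe) * N₀ := by
  obtain ⟨C, hC, h⟩ := klLevNormOf_jump_le_klEng m
  refine ⟨C, hC, fun R hR2 => ?_⟩
  obtain ⟨c₃, hc₃, U₀, hU₀, h'⟩ := h R hR2
  refine ⟨c₃, hc₃, U₀, hU₀, ?_⟩
  intro P c hP hc hc6 hc₃' μ hμ U hU hU9 hU₀' β hβmin hβc K hK L M _ _ hL3 hM3 J' hJ1 hJN Ωe N₀ hN0 hN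
  have hmain := h' P c hP hc hc6 hc₃' μ hμ U hU hU9 hU₀' β hβmin hβc K hK L M hL3 hM3 0 J' (by omega) hJN
    (klEffectiveAction L M β U μ K klE0 0) (klEffectiveAction_momentumConserving β U μ K klE0 0) Ωe N₀ hN0
    (fun Ωe' hlev => by rw [klLevNormOf_klEffectiveAction]; exact hN Ωe' hlev)
  simpa only [Nat.sub_zero] using hmain

end Summit.HubbardSuperconductivity.HubbardSuperconductivity.Theorems.EngineV8

end
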